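import Mathlib.Analysis.Calculus.MeanValue
import Mathlib.Analysis.InnerProductSpace.PiL2
import Mathlib.MeasureTheory.Integral.Bochner.Set
import Mathlib.MeasureTheory.Measure.Lebesgue.VolumeOfBalls
import Mathlib.MeasureTheory.Function.LocallyIntegrable
import Literature.Geometry.Lorentzian.Basic
import HarnessLib

/-!
# Far-cone retardation remainder, I: geometry of the retarded integrand

Support file 1 for the brick `SoftEraTubeLift.FarConeRetardationRemainder` of crux
`EIHFluxBalance.ModulatedKerrHandoff` (H′, stmt-FinalStateConjecture-17402; card `soft-era-tube-lift`,
sketch `Cruxes/ModulatedKerrHandoff/SketchIdeator5r2.lean`).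

Both the retarded field of the accelerated bump source and the boosted comoving field of the tangent
motion are, at the observation event `(t₀, x)`, *retarded integrals*
`I(c)(x) = ∫ φ(y − c(‖y − x‖)) / ‖y − x‖ dy`
along a CENTRE CURVE `c : ℝ → E3` (retarded distance `s = ‖y − x‖` ↦ position of the source centre at
lab time `t₀ − s`): `c₁(s) = ξ(t₀ − s)` for the true worldline, `c₀(s) = ξ(t₀) − s ξ̇(t₀)` for the
tangent line.  This file records the elementary geometry of such integrands for a bump `φ` supported
in the unit ball and a centre curve with `c(0) = ξ₀`, speed `≤ v < 1`, seen from a point `x` at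
distance `d = ‖x − ξ₀‖ ≥ 2`:

* `retardedDist_bounds`: on the support, `(d − 1) < (1 + v) s` and `(1 − v) s < d + 1`;
* `retarded_support_diam`: the support has diameter `< 2/(1 − v)`;
* `continuous_retarded`, `integrable_retarded`: the integrand is continuous and integrable;
* `abs_integral_retarded_le`: the crude bound `|I(c)(x)| ≤ ‖φ‖_∞ (1+v)/(d−1) · vol B(0, 2/(1−v))`.

Pure real analysis on `E3 = EuclideanSpace ℝ (Fin 3)`; Mathlib only. [folklore]
-/

noncomputable section

open MeasureTheory Set Filter Topology Metric Literature.Geometry.Lorentzian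

-- the doubled `FinalStateConjecture` path component is the summit/problem naming scheme
set_option linter.dupNamespace false

namespace Summit.FinalStateConjecture.FinalStateConjecture.Theorems.EIHFluxBalance.ModulatedKerrHandoffBricks.FarCone

/-! ### Speed bound ⇒ Lipschitz -/

/-- A differentiable curve with speed `≤ v` is `v`-Lipschitz. [folklore] -/
theorem norm_sub_le_of_speed {c : ℝ → E3} {v : ℝ} (hc : Differentiable ℝ c)
    (hcv : ∀ s, ‖deriv c s‖ ≤ v) (s s' : ℝ) : ‖c s - c s'‖ ≤ v * |s - s'| := by
  have h := Convex.norm_image_sub_le_of_norm_deriv_le (f := c) (s := univ) (C := v)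
    (fun z _ ↦ hc z) (fun z _ ↦ hcv z) convex_univ (mem_univ s') (mem_univ s)
  simpa [Real.norm_eq_abs] using h

/-! ### Support geometry -/

section Support

variable {φ : E3 → ℝ} {c : ℝ → E3} {v : ℝ} {x ξ₀ : E3}

/-- Off the unit ball the bump vanishes; contrapositive. [folklore] -/
theorem norm_lt_one_of_ne_zero (hφ0 : ∀ z : E3, 1 ≤ ‖z‖ → φ z = 0) {z : E3} (hz : φ z ≠ 0) :
    ‖z‖ < 1 := by
  by_contra h
  exact hz (hφ0 z (not_lt.1 h))

/-- **Retarded distance is pinned on the support.** If the bump centred at `c(s)`, `s = ‖y − x‖`,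
sees `y`, then `d − 1 < (1 + v) s` and `(1 − v) s < d + 1`, `d = ‖x − ξ₀‖`. [folklore] -/
theorem retardedDist_bounds (hc0 : c 0 = ξ₀) (hcv : ∀ s s', ‖c s - c s'‖ ≤ v * |s - s'|) {y : E3}
    (hy : ‖y - c ‖y - x‖‖ < 1) :
    ‖x - ξ₀‖ - 1 < (1 + v) * ‖y - x‖ ∧ (1 - v) * ‖y - x‖ < ‖x - ξ₀‖ + 1 := by
  set s := ‖y - x‖ with hs
  have hs0 : 0 ≤ s := norm_nonneg _
  have h1 : ‖c s - ξ₀‖ ≤ v * s := by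
    have := hcv s 0
    rwa [hc0, sub_zero, abs_of_nonneg hs0] at this
  constructor
  · -- `d ≤ ‖x - y‖ + ‖y - c s‖ + ‖c s - ξ₀‖ < s + 1 + v s`
    have : ‖x - ξ₀‖ ≤ ‖x - y‖ + ‖y - c s‖ + ‖c s - ξ₀‖ := by
      calc ‖x - ξ₀‖ = ‖(x - y) + (y - c s) + (c s - ξ₀)‖ := by congr 1; abel
        _ ≤ ‖(x - y) + (y - c s)‖ + ‖c s - ξ₀‖ := norm_add_le _ _
        _ ≤ ‖x - y‖ + ‖y - c s‖ + ‖c s - ξ₀‖ := by gcongr; exact norm_add_le _ _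
    rw [norm_sub_rev x y] at this
    nlinarith
  · -- `s ≤ ‖y - c s‖ + ‖c s - ξ₀‖ + ‖ξ₀ - x‖ < 1 + v s + d`
    have : s ≤ ‖y - c s‖ + ‖c s - ξ₀‖ + ‖ξ₀ - x‖ := by
      calc s = ‖(y - c s) + (c s - ξ₀) + (ξ₀ - x)‖ := by rw [hs]; congr 1; abel
        _ ≤ ‖(y - c s) + (c s - ξ₀)‖ + ‖ξ₀ - x‖ := norm_add_le _ _
        _ ≤ ‖y - c s‖ + ‖c s - ξ₀‖ + ‖ξ₀ - x‖ := by gcongr; exact norm_add_le _ _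
    rw [norm_sub_rev ξ₀ x] at this
    nlinarith

/-- Lower bound on the retarded distance on the support, in divided form. [folklore] -/
theorem lt_retardedDist (hc0 : c 0 = ξ₀) (hcv : ∀ s s', ‖c s - c s'‖ ≤ v * |s - s'|)
    (hv0 : 0 ≤ v) {y : E3} (hy : ‖y - c ‖y - x‖‖ < 1) :
    (‖x - ξ₀‖ - 1) / (1 + v) < ‖y - x‖ := by
  rw [div_lt_iff₀ (by linarith)]
  linarith [(retardedDist_bounds hc0 hcv hy).1]

/-- Upper bound on the retarded distance on the support, in divided form. [folklore] -/
theorem retardedDist_lt (hc0 : c 0 = ξ₀) (hcv : ∀ s s', ‖c s - c s'‖ ≤ v * |s - s'|)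
    (hv1 : v < 1) {y : E3} (hy : ‖y - c ‖y - x‖‖ < 1) :
    ‖y - x‖ < (‖x - ξ₀‖ + 1) / (1 - v) := by
  rw [lt_div_iff₀ (by linarith)]
  linarith [(retardedDist_bounds hc0 hcv hy).2]

/-- Off the support: if `(1 + v) ‖y − x‖ ≤ d − 1` the bump does not see `y`. [folklore] -/
theorem eq_zero_of_retardedDist_le (hφ0 : ∀ z : E3, 1 ≤ ‖z‖ → φ z = 0) (hc0 : c 0 = ξ₀)
    (hcv : ∀ s s', ‖c s - c s'‖ ≤ v * |s - s'|) {y : E3}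
    (hy : (1 + v) * ‖y - x‖ ≤ ‖x - ξ₀‖ - 1) : φ (y - c ‖y - x‖) = 0 := by
  by_contra h
  have := (retardedDist_bounds hc0 hcv (norm_lt_one_of_ne_zero hφ0 h)).1
  linarith

/-- **The support has diameter `< 2/(1 − v)`**: two points seen by the moving bump are within
`2/(1 − v)` of each other (`‖y₁ − y₂‖ < 2 + v‖y₁ − y₂‖`). [folklore] -/
theorem retarded_support_diam (hcv : ∀ s s', ‖c s - c s'‖ ≤ v * |s - s'|) (hv0 : 0 ≤ v)
    (hv1 : v < 1) {y₁ y₂ : E3} (h₁ : ‖y₁ - c ‖y₁ - x‖‖ < 1) (h₂ : ‖y₂ - c ‖y₂ - x‖‖ < 1) :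
    ‖y₁ - y₂‖ < 2 / (1 - v) := by
  have hcc : ‖c ‖y₁ - x‖ - c ‖y₂ - x‖‖ ≤ v * ‖y₁ - y₂‖ := by
    refine (hcv _ _).trans (mul_le_mul_of_nonneg_left ?_ hv0)
    have := abs_norm_sub_norm_le (y₁ - x) (y₂ - x)
    rwa [sub_sub_sub_cancel_right] at this
  have htri : ‖y₁ - y₂‖ ≤ ‖y₁ - c ‖y₁ - x‖‖ + ‖c ‖y₁ - x‖ - c ‖y₂ - x‖‖ + ‖y₂ - c ‖y₂ - x‖‖ := by
    calc ‖y₁ - y₂‖ = ‖(y₁ - c ‖y₁ - x‖) + (c ‖y₁ - x‖ - c ‖y₂ - x‖) - (y₂ - c ‖y₂ - x‖)‖ := by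
          congr 1; abel
      _ ≤ ‖(y₁ - c ‖y₁ - x‖) + (c ‖y₁ - x‖ - c ‖y₂ - x‖)‖ + ‖y₂ - c ‖y₂ - x‖‖ := norm_sub_le _ _
      _ ≤ _ := by gcongr; exact norm_add_le _ _
  rw [lt_div_iff₀ (by linarith)]
  nlinarith

end Support

/-! ### Continuity, integrability and the crude bound of the retarded integrand -/

section Integrand

variable {φ : E3 → ℝ} {c : ℝ → E3} {v : ℝ} {x ξ₀ : E3}

/-- The retarded integrand vanishes on the ball `(1 + v)‖y − x‖ < d − 1` about the observer.
[folklore] -/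
theorem retarded_eventuallyEq_zero (hφ0 : ∀ z : E3, 1 ≤ ‖z‖ → φ z = 0) (hc0 : c 0 = ξ₀)
    (hcv : ∀ s s', ‖c s - c s'‖ ≤ v * |s - s'|) (hv0 : 0 ≤ v) (hd : 1 < ‖x - ξ₀‖) :
    (fun y : E3 ↦ φ (y - c ‖y - x‖) / ‖y - x‖) =ᶠ[𝓝 x] fun _ ↦ 0 := by
  have hr : 0 < (‖x - ξ₀‖ - 1) / (1 + v) := div_pos (by linarith) (by linarith)
  filter_upwards [Metric.ball_mem_nhds x hr] with y hy
  rw [mem_ball, dist_eq_norm] at hy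
  have : (1 + v) * ‖y - x‖ ≤ ‖x - ξ₀‖ - 1 := by
    rw [lt_div_iff₀ (by linarith)] at hy
    linarith
  simp [eq_zero_of_retardedDist_le hφ0 hc0 hcv this]

/-- **Continuity of the retarded integrand** `y ↦ φ(y − c(‖y − x‖))/‖y − x‖` (away from `x` by
composition, at `x` because it vanishes near `x`). [folklore] -/
theorem continuous_retarded (hφc : Continuous φ) (hφ0 : ∀ z : E3, 1 ≤ ‖z‖ → φ z = 0)
    (hcc : Continuous c) (hc0 : c 0 = ξ₀) (hcv : ∀ s s', ‖c s - c s'‖ ≤ v * |s - s'|)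
    (hv0 : 0 ≤ v) (hd : 1 < ‖x - ξ₀‖) :
    Continuous fun y : E3 ↦ φ (y - c ‖y - x‖) / ‖y - x‖ := by
  have hnum : Continuous fun y : E3 ↦ φ (y - c ‖y - x‖) :=
    hφc.comp (continuous_id.sub (hcc.comp (continuous_id.sub continuous_const).norm))
  refine continuous_iff_continuousAt.2 fun y ↦ ?_
  by_cases hyx : y = x
  · subst hyx
    exact (continuousAt_const.congr (retarded_eventuallyEq_zero hφ0 hc0 hcv hv0 hd).symm)
  · have hne : ‖y - x‖ ≠ 0 := by
      rw [norm_ne_zero_iff]; exact sub_ne_zero.2 hyx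
    exact hnum.continuousAt.div ((continuous_id.sub continuous_const).norm.continuousAt) hne

/-- The retarded integrand vanishes outside the ball of radius `2/(1 − v)` about any point of its
support. [folklore] -/
theorem retarded_eq_zero_of_not_mem_closedBall (hφ0 : ∀ z : E3, 1 ≤ ‖z‖ → φ z = 0)
    (hcv : ∀ s s', ‖c s - c s'‖ ≤ v * |s - s'|) (hv0 : 0 ≤ v) (hv1 : v < 1) {y₀ y : E3}
    (hy₀ : φ (y₀ - c ‖y₀ - x‖) ≠ 0) (hy : y ∉ closedBall y₀ (2 / (1 - v))) :
    φ (y - c ‖y - x‖) / ‖y - x‖ = 0 := by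
  by_contra h
  have hy' : φ (y - c ‖y - x‖) ≠ 0 := fun h' ↦ h (by simp [h'])
  have := retarded_support_diam (x := x) hcv hv0 hv1 (norm_lt_one_of_ne_zero hφ0 hy₀)
    (norm_lt_one_of_ne_zero hφ0 hy')
  exact hy (mem_closedBall.2 (by rw [dist_eq_norm, norm_sub_rev]; exact this.le))

/-- **Integrability of the retarded integrand** (continuous, supported in a ball). [folklore] -/
theorem integrable_retarded (hφc : Continuous φ) (hφ0 : ∀ z : E3, 1 ≤ ‖z‖ → φ z = 0)
    (hcc : Continuous c) (hc0 : c 0 = ξ₀) (hcv : ∀ s s', ‖c s - c s'‖ ≤ v * |s - s'|)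
    (hv0 : 0 ≤ v) (hv1 : v < 1) (hd : 1 < ‖x - ξ₀‖) :
    Integrable fun y : E3 ↦ φ (y - c ‖y - x‖) / ‖y - x‖ := by
  have hcont := continuous_retarded hφc hφ0 hcc hc0 hcv hv0 hd
  by_cases hne : ∃ y₀ : E3, φ (y₀ - c ‖y₀ - x‖) ≠ 0
  · obtain ⟨y₀, hy₀⟩ := hne
    refine hcont.integrable_of_hasCompactSupport ?_
    refine HasCompactSupport.intro (isCompact_closedBall y₀ (2 / (1 - v))) fun y hy ↦ ?_
    exact retarded_eq_zero_of_not_mem_closedBall hφ0 hcv hv0 hv1 hy₀ hy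
  · push Not at hne
    have : (fun y : E3 ↦ φ (y - c ‖y - x‖) / ‖y - x‖) = fun _ ↦ 0 := by
      funext y; simp [hne y]
    rw [this]
    exact integrable_zero _ _ _

/-- **Crude bound**: `|I(c)(x)| ≤ ‖φ‖_∞ · (1 + v)/(d − 1) · vol B̄(0, 2/(1 − v))` for `d = ‖x − ξ₀‖ > 1`
(the integrand is at most `‖φ‖_∞ (1+v)/(d−1)` and lives in a ball of radius `2/(1−v)`). [folklore] -/
theorem abs_integral_retarded_le (hφ0 : ∀ z : E3, 1 ≤ ‖z‖ → φ z = 0) {Φ : ℝ}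
    (hΦ : ∀ z, |φ z| ≤ Φ) (hc0 : c 0 = ξ₀) (hcv : ∀ s s', ‖c s - c s'‖ ≤ v * |s - s'|)
    (hv0 : 0 ≤ v) (hv1 : v < 1) (hd : 1 < ‖x - ξ₀‖) :
    |∫ y : E3, φ (y - c ‖y - x‖) / ‖y - x‖| ≤
      Φ * ((1 + v) / (‖x - ξ₀‖ - 1)) * (volume (closedBall (0 : E3) (2 / (1 - v)))).toReal := by
  have hΦ0 : 0 ≤ Φ := (abs_nonneg _).trans (hΦ 0)
  have hK0 : 0 ≤ Φ * ((1 + v) / (‖x - ξ₀‖ - 1)) :=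
    mul_nonneg hΦ0 (div_nonneg (by linarith) (by linarith))
  by_cases hne : ∃ y₀ : E3, φ (y₀ - c ‖y₀ - x‖) ≠ 0
  · obtain ⟨y₀, hy₀⟩ := hne
    set B := closedBall y₀ (2 / (1 - v)) with hB
    have hvol : volume B = volume (closedBall (0 : E3) (2 / (1 - v))) := by
      rw [hB, Measure.addHaar_closedBall_center]
    have hout : ∀ y ∉ B, φ (y - c ‖y - x‖) / ‖y - x‖ = 0 := fun y hy ↦
      retarded_eq_zero_of_not_mem_closedBall hφ0 hcv hv0 hv1 hy₀ hy
    rw [← setIntegral_eq_integral_of_forall_compl_eq_zero hout, ← hvol, ← Real.norm_eq_abs]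
    refine (norm_setIntegral_le_of_norm_le_const (measure_closedBall_lt_top) fun y _ ↦ ?_).trans
      (le_of_eq (by rw [measureReal_def]))
    -- pointwise bound on the ball
    rw [Real.norm_eq_abs]
    by_cases hφy : φ (y - c ‖y - x‖) = 0
    · simp [hφy, hK0]
    · have hs : (‖x - ξ₀‖ - 1) / (1 + v) < ‖y - x‖ :=
        lt_retardedDist hc0 hcv hv0 (norm_lt_one_of_ne_zero hφ0 hφy)
      have hd1 : (0 : ℝ) < ‖x - ξ₀‖ - 1 := by linarith
      have hv2 : (0 : ℝ) < 1 + v := by linarith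
      have hspos : 0 < ‖y - x‖ := (div_pos hd1 hv2).trans hs
      rw [abs_div, abs_of_pos hspos, div_le_iff₀ hspos]
      calc |φ (y - c ‖y - x‖)| ≤ Φ := hΦ _
        _ = Φ * ((1 + v) / (‖x - ξ₀‖ - 1)) * ((‖x - ξ₀‖ - 1) / (1 + v)) := by
            rw [mul_assoc, div_mul_div_comm, mul_comm (‖x - ξ₀‖ - 1) (1 + v),
              div_self (mul_ne_zero hv2.ne' hd1.ne'), mul_one]
        _ ≤ Φ * ((1 + v) / (‖x - ξ₀‖ - 1)) * ‖y - x‖ :=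
            mul_le_mul_of_nonneg_left hs.le hK0
  · push Not at hne
    have : (fun y : E3 ↦ φ (y - c ‖y - x‖) / ‖y - x‖) = fun _ ↦ 0 := by
      funext y; simp [hne y]
    rw [this, integral_zero, abs_zero]
    positivity

end Integrand

/-! ### Registered form -/

/-- **Crude bound on a retarded integral** (registered helper of stmt-FinalStateConjecture-17402, brick
`FarConeRetardationRemainder`): `|∫ φ(y − c(‖y−x‖))/‖y−x‖ dy| ≤ ‖φ‖_∞ (1+v)/(d−1) · vol B̄(0, 2/(1−v))`.
[folklore] -/
theorem farCone_abs_integral_retarded_le : ∀ (φ : EuclideanSpace ℝ (Fin 3) → ℝ) (c : ℝ → EuclideanSpace ℝ (Fin 3)) (v Φ : ℝ) (x ξ₀ : EuclideanSpace ℝ (Fin 3)), (∀ z, 1 ≤ ‖z‖ → φ z = 0) → (∀ z, |φ z| ≤ Φ) → c 0 = ξ₀ → (∀ s s', ‖c s - c s'‖ ≤ v * |s - s'|) → 0 ≤ v → v < 1 → 1 < ‖x - ξ₀‖ → |MeasureTheory.integral MeasureTheory.volume (fun y : EuclideanSpace ℝ (Fin 3) ↦ φ (y - c ‖y - x‖)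 / ‖y - x‖)| ≤ Φ * ((1 + v) / (‖x - ξ₀‖ - 1)) * (MeasureTheory.volume (Metric.closedBall (0 : EuclideanSpace ℝ (Fin 3)) (2 / (1 - v)))).toReal :=
  fun _φ _c _v _Φ _x _ξ₀ hφ0 hΦ hc0 hcv hv0 hv1 hd ↦ abs_integral_retarded_le hφ0 hΦ hc0 hcv hv0 hv1 hd

end Summit.FinalStateConjecture.FinalStateConjecture.Theorems.EIHFluxBalance.ModulatedKerrHandoffBricks.FarCone

end
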